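import Literature.NumberTheory.EllipticCurves.NewformOpenImageExpProofs
import HarnessLib

/-!
# Open image, III: the Lie lattice of a subgroup of `GL₂(ℤ_ℓ)` (proofs file)

Sibling proofs file of `NewformOpenImage.lean` (theorems only, no definitions: the two lattices
below are written out as explicit set-builder expressions in every statement).  For a subgroup
`G ≤ GL₂(ℤ_ℓ)` and a level `s ≥ 3` put

  `Λₛ(G) = {a ∈ M₂(ℤ_ℓ) | exp (ℓˢ a) ∈ G}`,  `Λ∞(G) = closure (⋃_{s ≥ 3} Λₛ(G)) ⊆ M₂(ℤ_ℓ)`,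

where `exp : ℓˢ M₂(ℤ_ℓ) ≃ Γ(ℓˢ)` is the bijection of `NewformOpenImageExpProofs.lean`.  This is
an elementary substitute for the `ℓ`-adic Lie algebra of `G` (Serre, *Abelian ℓ-adic
representations*, Ch. IV; Lazard): `ℚ_ℓ ⊗ Λ∞(G)` is the Lie algebra, and everything is proved
from the congruences of the exponential, without Campbell–Hausdorff:

* `OpenImage.nsmul_mem_lattice`, `mem_lattice_succ`, `mem_lattice_of_le`,
  `smul_mem_lattice_of_mem_succ`, `mem_lattice_succ_of_smul_mem`, `exists_mem_lattice_of_mem`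
  (every `g ∈ G ∩ Γ(ℓˢ)` is `exp (ℓˢ a)`, `a ∈ Λₛ(G)`), `isClosed_lattice` (for closed `G`).
* `OpenImage.map_commutator_eq_of_le` — commutators are graded brackets to higher precision:
  `(1 + ℓᵃ x, 1 + ℓᵇ y) ≡ 1 + ℓ^{a+b} [x, y] (mod ℓ^{a+b+m})`, `m ≤ min(a, b)`.
* `OpenImage.exists_mem_lattice_sub_add_dvd`, `exists_mem_lattice_sub_bracket_dvd` — sums and
  brackets exist inside the lattices to first order (`mod ℓ^{s−1}`).
* `OpenImage.add_mem_latticeInfty`, `smul_mem_latticeInfty` (`ℤ_ℓ`-module: `ℕ` acts by powers,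
  and is dense in `ℤ_ℓ`), `neg_mem_latticeInfty`, `sub_mem_latticeInfty`,
  `bracket_mem_latticeInfty`, `mem_latticeInfty_of_smul_mem` (**saturation**),
  `mem_latticeInfty_of_forall_exists` (limit criterion), `exists_dvd_sub_of_mem_closure`.
* `OpenImage.exists_mulVec_eq_smul_of_forall_mem_lattice` — **from the Lie lattice back to
  the group**: if `Λ₃(G)` preserves a line `E v` (`E ⊇ ℚ_ℓ` any field) then so does
  `G ∩ Γ(ℓ³)` (the stabiliser of a line is a closed unital subalgebra of `M₂(ℚ_ℓ)`, and
  `exp (ℓ³ a)` is a limit of polynomials in `a`).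
* `OpenImage.bracket_mem_span_latticeInfty`, `mem_latticeInfty_of_map_mem_span` — the
  `ℚ_ℓ`-span of `ι(Λ∞(G))` is a Lie subalgebra of `𝔤𝔩₂(ℚ_ℓ)` with no new integral points.

Next file: the `2 × 2` Lie-algebra computation (`𝔤 ⊉ 𝔰𝔩₂ ⇒` invariant line) and the engine
theorem feeding `OpenImage.isOpen_range_of_sl2_meets_of_det`.

## References

* J.-P. Serre, *Abelian ℓ-adic representations and elliptic curves*, Benjamin 1968, Ch. IV,
  and *Lie algebras and Lie groups*, LNM 1500, Part II, Ch. V §7–§9. [SerreAbelianLadic1968]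
* M. Lazard, Groupes analytiques `p`-adiques, Publ. Math. IHÉS 26 (1965), Ch. III (filtrations,
  graded Lie algebras, saturation).
* K. A. Ribet, *On ℓ-adic representations attached to modular forms II*, Glasgow Math. J. 27
  (1985) 185–194, §3. [Ribet1985]
-/

noncomputable section

open scoped MatrixGroups NNReal ENNReal Nat
open Matrix Filter Topology NormedSpace

namespace Literature.NumberTheory.EllipticCurves.ModularForms

namespace OpenImage

open Literature.GroupTheory.Index

variable {ℓ : ℕ} [Fact ℓ.Prime]

/-! ### The inclusion `ι : M₂(ℤ_ℓ) → M₂(ℚ_ℓ)` -/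

/-- `ι(A B) = ι(A) ι(B)`. [folklore] -/
theorem map_coe_mul (A B : Matrix (Fin 2) (Fin 2) ℤ_[ℓ]) : (A * B).map ((↑) : ℤ_[ℓ] → ℚ_[ℓ]) = A.map ((↑) : ℤ_[ℓ] → ℚ_[ℓ]) * B.map ((↑) : ℤ_[ℓ] → ℚ_[ℓ]) :=
  Matrix.map_mul (f := PadicInt.Coe.ringHom (p := ℓ))

/-- `ι(Aⁿ) = ι(A)ⁿ`. [folklore] -/
theorem map_coe_pow (A : Matrix (Fin 2) (Fin 2) ℤ_[ℓ]) (n : ℕ) : (A ^ n).map ((↑) : ℤ_[ℓ] → ℚ_[ℓ]) = A.map ((↑) : ℤ_[ℓ] → ℚ_[ℓ]) ^ n :=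
  map_pow (PadicInt.Coe.ringHom (p := ℓ)).mapMatrix A n

/-- `ι(A - B) = ι(A) - ι(B)`. [folklore] -/
theorem map_coe_sub (A B : Matrix (Fin 2) (Fin 2) ℤ_[ℓ]) : (A - B).map ((↑) : ℤ_[ℓ] → ℚ_[ℓ]) = A.map ((↑) : ℤ_[ℓ] → ℚ_[ℓ]) - B.map ((↑) : ℤ_[ℓ] → ℚ_[ℓ]) :=
  map_sub (PadicInt.Coe.ringHom (p := ℓ)).mapMatrix A B

/-- `ι(A + B) = ι(A) + ι(B)`. [folklore] -/
theorem map_coe_add (A B : Matrix (Fin 2) (Fin 2) ℤ_[ℓ]) : (A + B).map ((↑) : ℤ_[ℓ] → ℚ_[ℓ]) = A.map ((↑) : ℤ_[ℓ] → ℚ_[ℓ]) + B.map ((↑) : ℤ_[ℓ] → ℚ_[ℓ]) :=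
  map_add (PadicInt.Coe.ringHom (p := ℓ)).mapMatrix A B

/-- `ι(c • A) = c • ι(A)`. [folklore] -/
theorem map_coe_smul (c : ℤ_[ℓ]) (A : Matrix (Fin 2) (Fin 2) ℤ_[ℓ]) : (c • A).map ((↑) : ℤ_[ℓ] → ℚ_[ℓ]) = (c : ℚ_[ℓ]) • A.map ((↑) : ℤ_[ℓ] → ℚ_[ℓ]) := by
  ext i j
  simp

/-- `ι(0) = 0`. [folklore] -/
theorem map_coe_zero : (0 : Matrix (Fin 2) (Fin 2) ℤ_[ℓ]).map ((↑) : ℤ_[ℓ] → ℚ_[ℓ]) = 0 :=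
  map_zero (PadicInt.Coe.ringHom (p := ℓ)).mapMatrix

/-- `ι(1) = 1`. [folklore] -/
theorem map_coe_one : (1 : Matrix (Fin 2) (Fin 2) ℤ_[ℓ]).map ((↑) : ℤ_[ℓ] → ℚ_[ℓ]) = 1 :=
  map_one (PadicInt.Coe.ringHom (p := ℓ)).mapMatrix

/-! ### The Lie lattices `Λₛ(G)` of a subgroup `G ≤ GL₂(ℤ_ℓ)` -/

/-- `0 ∈ Λₛ(G)`. [folklore] -/
theorem zero_mem_lattice (G : Subgroup (GL (Fin 2) ℤ_[ℓ])) (s : ℕ) : (0 : Matrix (Fin 2) (Fin 2) ℤ_[ℓ]) ∈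
    {a : Matrix (Fin 2) (Fin 2) ℤ_[ℓ] | ∃ g ∈ G,
          (g : Matrix (Fin 2) (Fin 2) ℤ_[ℓ]).map ((↑) : ℤ_[ℓ] → ℚ_[ℓ]) =
            NormedSpace.exp ((ℓ : ℚ_[ℓ]) ^ s • a.map ((↑) : ℤ_[ℓ] → ℚ_[ℓ]))} := by
  refine ⟨1, G.one_mem, ?_⟩
  rw [map_coe_zero, smul_zero, exp_zero, Units.val_one, map_coe_one]

/-- `Λₛ(G)` is stable under multiplication by naturals (`s ≥ 3`). [folklore] -/
theorem nsmul_mem_lattice {G : Subgroup (GL (Fin 2) ℤ_[ℓ])} {s : ℕ} (hs : 3 ≤ s)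
    {a : Matrix (Fin 2) (Fin 2) ℤ_[ℓ]} (ha : a ∈ {a : Matrix (Fin 2) (Fin 2) ℤ_[ℓ] | ∃ g ∈ G,
          (g : Matrix (Fin 2) (Fin 2) ℤ_[ℓ]).map ((↑) : ℤ_[ℓ] → ℚ_[ℓ]) =
            NormedSpace.exp ((ℓ : ℚ_[ℓ]) ^ s • a.map ((↑) : ℤ_[ℓ] → ℚ_[ℓ]))}) (n : ℕ) : n • a ∈
                {a : Matrix (Fin 2) (Fin 2) ℤ_[ℓ] | ∃ g ∈ G,
                      (g : Matrix (Fin 2) (Fin 2) ℤ_[ℓ]).map ((↑) : ℤ_[ℓ] → ℚ_[ℓ]) =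
                        NormedSpace.exp ((ℓ : ℚ_[ℓ]) ^ s • a.map ((↑) : ℤ_[ℓ] → ℚ_[ℓ]))} := by
  obtain ⟨g, hg, hga⟩ := ha
  refine ⟨g ^ n, G.pow_mem hg n, ?_⟩
  rw [exp_smul_map_nsmul hs, ← hga, Units.val_pow_eq_pow_val, map_coe_pow]

/-- `Λₛ(G) ⊆ Λ_{s+1}(G)` (`s ≥ 3`): raising the level is taking `ℓ`-th powers. [folklore] -/
theorem mem_lattice_succ {G : Subgroup (GL (Fin 2) ℤ_[ℓ])} {s : ℕ} (hs : 3 ≤ s)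
    {a : Matrix (Fin 2) (Fin 2) ℤ_[ℓ]} (ha : a ∈ {a : Matrix (Fin 2) (Fin 2) ℤ_[ℓ] | ∃ g ∈ G,
          (g : Matrix (Fin 2) (Fin 2) ℤ_[ℓ]).map ((↑) : ℤ_[ℓ] → ℚ_[ℓ]) =
            NormedSpace.exp ((ℓ : ℚ_[ℓ]) ^ s • a.map ((↑) : ℤ_[ℓ] → ℚ_[ℓ]))}) : a ∈
                {a : Matrix (Fin 2) (Fin 2) ℤ_[ℓ] | ∃ g ∈ G,
                      (g : Matrix (Fin 2) (Fin 2) ℤ_[ℓ]).map ((↑) : ℤ_[ℓ] → ℚ_[ℓ]) =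
                        NormedSpace.exp ((ℓ : ℚ_[ℓ]) ^ (s + 1) • a.map ((↑) : ℤ_[ℓ] → ℚ_[ℓ]))} := by
  obtain ⟨g, hg, hga⟩ := ha
  refine ⟨g ^ ℓ, G.pow_mem hg ℓ, ?_⟩
  rw [exp_pow_succ_smul_map hs, ← hga, Units.val_pow_eq_pow_val, map_coe_pow]

/-- `Λₛ(G) ⊆ Λₜ(G)` for `3 ≤ s ≤ t`. [folklore] -/
theorem mem_lattice_of_le {G : Subgroup (GL (Fin 2) ℤ_[ℓ])} {s t : ℕ} (hs : 3 ≤ s) (hst : s ≤ t)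
    {a : Matrix (Fin 2) (Fin 2) ℤ_[ℓ]} (ha : a ∈ {a : Matrix (Fin 2) (Fin 2) ℤ_[ℓ] | ∃ g ∈ G,
          (g : Matrix (Fin 2) (Fin 2) ℤ_[ℓ]).map ((↑) : ℤ_[ℓ] → ℚ_[ℓ]) =
            NormedSpace.exp ((ℓ : ℚ_[ℓ]) ^ s • a.map ((↑) : ℤ_[ℓ] → ℚ_[ℓ]))}) : a ∈
                {a : Matrix (Fin 2) (Fin 2) ℤ_[ℓ] | ∃ g ∈ G,
                      (g : Matrix (Fin 2) (Fin 2) ℤ_[ℓ]).map ((↑) : ℤ_[ℓ] → ℚ_[ℓ]) =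
                        NormedSpace.exp ((ℓ : ℚ_[ℓ]) ^ t • a.map ((↑) : ℤ_[ℓ] → ℚ_[ℓ]))} := by
  induction t, hst using Nat.le_induction with
  | base => exact ha
  | succ t hst ih => exact mem_lattice_succ (hs.trans hst) ih

/-- `ℓ • Λ_{s+1}(G) ⊆ Λₛ(G)`. [folklore] -/
theorem smul_mem_lattice_of_mem_succ {G : Subgroup (GL (Fin 2) ℤ_[ℓ])} {s : ℕ}
    {a : Matrix (Fin 2) (Fin 2) ℤ_[ℓ]} (ha : a ∈ {a : Matrix (Fin 2) (Fin 2) ℤ_[ℓ] | ∃ g ∈ G,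
          (g : Matrix (Fin 2) (Fin 2) ℤ_[ℓ]).map ((↑) : ℤ_[ℓ] → ℚ_[ℓ]) =
            NormedSpace.exp ((ℓ : ℚ_[ℓ]) ^ (s + 1) • a.map ((↑) : ℤ_[ℓ] → ℚ_[ℓ]))}) : (ℓ : ℤ_[ℓ]) • a ∈
                {a : Matrix (Fin 2) (Fin 2) ℤ_[ℓ] | ∃ g ∈ G,
                      (g : Matrix (Fin 2) (Fin 2) ℤ_[ℓ]).map ((↑) : ℤ_[ℓ] → ℚ_[ℓ]) =
                        NormedSpace.exp ((ℓ : ℚ_[ℓ]) ^ s • a.map ((↑) : ℤ_[ℓ] → ℚ_[ℓ]))} := by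
  obtain ⟨g, hg, hga⟩ := ha
  refine ⟨g, hg, ?_⟩
  rw [hga]
  congr 1
  ext i j
  simp only [Matrix.smul_apply, Matrix.map_apply, smul_eq_mul, PadicInt.coe_mul, PadicInt.coe_natCast]
  ring

/-- Conversely `ℓ • a ∈ Λₛ(G)` implies `a ∈ Λ_{s+1}(G)`. [folklore] -/
theorem mem_lattice_succ_of_smul_mem {G : Subgroup (GL (Fin 2) ℤ_[ℓ])} {s : ℕ}
    {a : Matrix (Fin 2) (Fin 2) ℤ_[ℓ]} (ha : (ℓ : ℤ_[ℓ]) • a ∈ {a : Matrix (Fin 2) (Fin 2) ℤ_[ℓ] | ∃ g ∈ G,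
          (g : Matrix (Fin 2) (Fin 2) ℤ_[ℓ]).map ((↑) : ℤ_[ℓ] → ℚ_[ℓ]) =
            NormedSpace.exp ((ℓ : ℚ_[ℓ]) ^ s • a.map ((↑) : ℤ_[ℓ] → ℚ_[ℓ]))}) : a ∈
                {a : Matrix (Fin 2) (Fin 2) ℤ_[ℓ] | ∃ g ∈ G,
                      (g : Matrix (Fin 2) (Fin 2) ℤ_[ℓ]).map ((↑) : ℤ_[ℓ] → ℚ_[ℓ]) =
                        NormedSpace.exp ((ℓ : ℚ_[ℓ]) ^ (s + 1) • a.map ((↑) : ℤ_[ℓ] → ℚ_[ℓ]))} := by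
  obtain ⟨g, hg, hga⟩ := ha
  refine ⟨g, hg, ?_⟩
  rw [hga]
  congr 1
  ext i j
  simp only [Matrix.smul_apply, Matrix.map_apply, smul_eq_mul, PadicInt.coe_mul, PadicInt.coe_natCast]
  ring

/-- Every element of `G ∩ Γ(ℓˢ)` (`s ≥ 3`) is `exp (ℓˢ a)` with `a ∈ Λₛ(G)` (the logarithm).
[folklore] -/
theorem exists_mem_lattice_of_mem {G : Subgroup (GL (Fin 2) ℤ_[ℓ])} {s : ℕ} (hs : 3 ≤ s)
    {g : GL (Fin 2) ℤ_[ℓ]} (hgG : g ∈ G) (hg : g ∈ GL2.congruenceSubgroup (p := ℓ) s) :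
    ∃ a ∈ {a : Matrix (Fin 2) (Fin 2) ℤ_[ℓ] | ∃ g ∈ G,
          (g : Matrix (Fin 2) (Fin 2) ℤ_[ℓ]).map ((↑) : ℤ_[ℓ] → ℚ_[ℓ]) =
            NormedSpace.exp ((ℓ : ℚ_[ℓ]) ^ s • a.map ((↑) : ℤ_[ℓ] → ℚ_[ℓ]))}, (g : Matrix (Fin 2) (Fin 2) ℤ_[ℓ]).map ((↑) : ℤ_[ℓ] → ℚ_[ℓ]) = exp ((ℓ : ℚ_[ℓ]) ^ s • a.map ((↑) : ℤ_[ℓ] → ℚ_[ℓ])) := by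
  obtain ⟨a, ha⟩ := exists_map_eq_exp_smul_map_of_mem hs hg
  exact ⟨a, ⟨g, hgG, ha⟩, ha⟩

/-- For a closed subgroup `G`, the lattice `Λₛ(G)` is closed in `M₂(ℤ_ℓ)` (`s ≥ 3`). [folklore] -/
theorem isClosed_lattice {G : Subgroup (GL (Fin 2) ℤ_[ℓ])} (hG : IsClosed (G : Set (GL (Fin 2) ℤ_[ℓ])))
    {s : ℕ} (hs : 3 ≤ s) : IsClosed {a : Matrix (Fin 2) (Fin 2) ℤ_[ℓ] | ∃ g ∈ G,
          (g : Matrix (Fin 2) (Fin 2) ℤ_[ℓ]).map ((↑) : ℤ_[ℓ] → ℚ_[ℓ]) =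
            NormedSpace.exp ((ℓ : ℚ_[ℓ]) ^ s • a.map ((↑) : ℤ_[ℓ] → ℚ_[ℓ]))} := by
  haveI : CompactSpace (Matrix (Fin 2) (Fin 2) ℤ_[ℓ]) :=
    inferInstanceAs (CompactSpace (Fin 2 → Fin 2 → ℤ_[ℓ]))
  have hc : IsClosed ((fun g : GL (Fin 2) ℤ_[ℓ] ↦ (g : Matrix (Fin 2) (Fin 2) ℤ_[ℓ]).map ((↑) : ℤ_[ℓ] → ℚ_[ℓ])) ''
      (G : Set (GL (Fin 2) ℤ_[ℓ]))) :=
    (hG.isCompact.image (Units.continuous_val.matrix_map continuous_subtype_val)).isClosed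
  have he : {a : Matrix (Fin 2) (Fin 2) ℤ_[ℓ] | ∃ g ∈ G,
        (g : Matrix (Fin 2) (Fin 2) ℤ_[ℓ]).map ((↑) : ℤ_[ℓ] → ℚ_[ℓ]) =
          NormedSpace.exp ((ℓ : ℚ_[ℓ]) ^ s • a.map ((↑) : ℤ_[ℓ] → ℚ_[ℓ]))} = (fun a : Matrix (Fin 2) (Fin 2) ℤ_[ℓ] ↦ exp ((ℓ : ℚ_[ℓ]) ^ s • a.map ((↑) : ℤ_[ℓ] → ℚ_[ℓ]))) ⁻¹'
      ((fun g : GL (Fin 2) ℤ_[ℓ] ↦ (g : Matrix (Fin 2) (Fin 2) ℤ_[ℓ]).map ((↑) : ℤ_[ℓ] → ℚ_[ℓ])) '' (G : Set (GL (Fin 2) ℤ_[ℓ]))) := by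
    ext a
    simp only [Set.mem_setOf_eq, Set.mem_preimage, Set.mem_image, SetLike.mem_coe]
  rw [he]
  exact hc.preimage (continuous_exp_smul_map hs)

/-! ### Commutators to higher precision -/

/-- **Commutators are graded brackets, to higher precision.**  For `g = 1 + ℓᵃ x`, `h = 1 + ℓᵇ y`
in `GL₂(ℤ_ℓ)` and `m ≤ min(a, b)`:
`g h g⁻¹ h⁻¹ ≡ 1 + ℓ^{a+b} (x y − y x) (mod ℓ^{a+b+m})`. [folklore] -/
theorem map_commutator_eq_of_le {a b m : ℕ} (hma : m ≤ a) (hmb : m ≤ b) {g h : GL (Fin 2) ℤ_[ℓ]}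
    {x y : Matrix (Fin 2) (Fin 2) ℤ_[ℓ]}
    (hg : (g : Matrix (Fin 2) (Fin 2) ℤ_[ℓ]) = 1 + (ℓ : ℤ_[ℓ]) ^ a • x)
    (hh : (h : Matrix (Fin 2) (Fin 2) ℤ_[ℓ]) = 1 + (ℓ : ℤ_[ℓ]) ^ b • y) :
    ((g * h * g⁻¹ * h⁻¹ : GL (Fin 2) ℤ_[ℓ]) : Matrix (Fin 2) (Fin 2) ℤ_[ℓ]).map
        (PadicInt.toZModPow (a + b + m)) =
      (1 + (ℓ : ℤ_[ℓ]) ^ (a + b) • (x * y - y * x)).map (PadicInt.toZModPow (a + b + m)) := by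
  obtain ⟨a, rfl⟩ : ∃ a', a = m + a' := ⟨a - m, by omega⟩
  obtain ⟨b, rfl⟩ : ∃ b', b = m + b' := ⟨b - m, by omega⟩
  set c : GL (Fin 2) ℤ_[ℓ] := g * h * g⁻¹ * h⁻¹ with hc
  have hchg : c * (h * g) = g * h := by
    rw [hc]; group
  set L : ℤ_[ℓ] := (ℓ : ℤ_[ℓ]) with hL
  set z : Matrix (Fin 2) (Fin 2) ℤ_[ℓ] := x * y - y * x with hz
  have hkey : (1 + L ^ (m + a + (m + b)) • z) * ((h : Matrix (Fin 2) (Fin 2) ℤ_[ℓ]) * g) =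
      (g : Matrix (Fin 2) (Fin 2) ℤ_[ℓ]) * h +
        L ^ (m + a + (m + b) + m) • (L ^ a • (z * x) + L ^ b • (z * y) + L ^ (a + (m + b)) • (z * (y * x))) := by
    have hzdef : x * y = z + y * x := by rw [hz, sub_add_cancel]
    rw [hg, hh]
    simp only [mul_add, add_mul, one_mul, mul_one, smul_mul_assoc, mul_smul_comm, smul_add, smul_smul,
      ← mul_assoc, hzdef]
    module
  have hred : ((c : GL (Fin 2) ℤ_[ℓ]) : Matrix (Fin 2) (Fin 2) ℤ_[ℓ]).map
        (PadicInt.toZModPow (m + a + (m + b) + m)) *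
      ((h * g : GL (Fin 2) ℤ_[ℓ]) : Matrix (Fin 2) (Fin 2) ℤ_[ℓ]).map
        (PadicInt.toZModPow (m + a + (m + b) + m)) =
      (1 + L ^ (m + a + (m + b)) • z).map (PadicInt.toZModPow (m + a + (m + b) + m)) *
      ((h * g : GL (Fin 2) ℤ_[ℓ]) : Matrix (Fin 2) (Fin 2) ℤ_[ℓ]).map
        (PadicInt.toZModPow (m + a + (m + b) + m)) := by
    rw [← Matrix.map_mul, ← Matrix.map_mul, ← Units.val_mul, hchg, Units.val_mul, Units.val_mul, hkey,
      hL, map_add_smul_pow_eq le_rfl]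
  have hu : ((h * g : GL (Fin 2) ℤ_[ℓ]) : Matrix (Fin 2) (Fin 2) ℤ_[ℓ]).map
        (PadicInt.toZModPow (m + a + (m + b) + m)) =
      ((Matrix.GeneralLinearGroup.map (PadicInt.toZModPow (m + a + (m + b) + m)) (h * g) :
        GL (Fin 2) (ZMod (ℓ ^ (m + a + (m + b) + m)))) :
          Matrix (Fin 2) (Fin 2) (ZMod (ℓ ^ (m + a + (m + b) + m)))) := rfl
  rw [hu, Units.mul_left_inj] at hred
  exact hred

/-! ### Sums and brackets inside the lattices, to first order -/

/-- **Sums.**  For `a, b ∈ Λₛ(G)` (`s ≥ 3`) there is `c ∈ Λₛ(G)` with `c ≡ a + b (mod ℓ^{s−1})`: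
take `exp (ℓˢ c) = exp (ℓˢ a) exp (ℓˢ b)`. [folklore] -/
theorem exists_mem_lattice_sub_add_dvd {G : Subgroup (GL (Fin 2) ℤ_[ℓ])} {s : ℕ} (hs : 3 ≤ s)
    {a b : Matrix (Fin 2) (Fin 2) ℤ_[ℓ]} (ha : a ∈ {a : Matrix (Fin 2) (Fin 2) ℤ_[ℓ] | ∃ g ∈ G,
          (g : Matrix (Fin 2) (Fin 2) ℤ_[ℓ]).map ((↑) : ℤ_[ℓ] → ℚ_[ℓ]) =
            NormedSpace.exp ((ℓ : ℚ_[ℓ]) ^ s • a.map ((↑) : ℤ_[ℓ] → ℚ_[ℓ]))}) (hb : b ∈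
                {a : Matrix (Fin 2) (Fin 2) ℤ_[ℓ] | ∃ g ∈ G,
                      (g : Matrix (Fin 2) (Fin 2) ℤ_[ℓ]).map ((↑) : ℤ_[ℓ] → ℚ_[ℓ]) =
                        NormedSpace.exp ((ℓ : ℚ_[ℓ]) ^ s • a.map ((↑) : ℤ_[ℓ] → ℚ_[ℓ]))}) :
    ∃ c ∈ {a : Matrix (Fin 2) (Fin 2) ℤ_[ℓ] | ∃ g ∈ G,
          (g : Matrix (Fin 2) (Fin 2) ℤ_[ℓ]).map ((↑) : ℤ_[ℓ] → ℚ_[ℓ]) =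
            NormedSpace.exp ((ℓ : ℚ_[ℓ]) ^ s • a.map ((↑) : ℤ_[ℓ] → ℚ_[ℓ]))}, ∀ i j, (ℓ : ℤ_[ℓ]) ^ (s - 1) ∣ (c - (a + b)) i j := by
  obtain ⟨ga, hgaG, hga⟩ := ha
  obtain ⟨gb, hgbG, hgb⟩ := hb
  obtain ⟨ra, hra⟩ := exists_eq_one_add_smul_add_of_map_eq_exp hs hga
  obtain ⟨rb, hrb⟩ := exists_eq_one_add_smul_add_of_map_eq_exp hs hgb
  have hmem : ga * gb ∈ GL2.congruenceSubgroup (p := ℓ) s :=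
    Subgroup.mul_mem _ (mem_congruenceSubgroup_of_map_eq_exp hs hga) (mem_congruenceSubgroup_of_map_eq_exp hs hgb)
  obtain ⟨c, hc⟩ := exists_map_eq_exp_smul_map_of_mem hs hmem
  obtain ⟨rc, hrc⟩ := exists_eq_one_add_smul_add_of_map_eq_exp hs hc
  refine ⟨c, ⟨ga * gb, G.mul_mem hgaG hgbG, hc⟩, ?_⟩
  obtain ⟨s, rfl⟩ : ∃ s', s = s' + 1 := ⟨s - 1, by omega⟩
  rw [Nat.add_sub_cancel]
  set L : ℤ_[ℓ] := (ℓ : ℤ_[ℓ]) with hL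
  have h2s : 2 * (s + 1) - 1 = s + 1 + s := by omega
  rw [h2s] at hra hrb hrc
  -- compare the two expressions for `ga gb`
  have hprod : ((ga * gb : GL (Fin 2) ℤ_[ℓ]) : Matrix (Fin 2) (Fin 2) ℤ_[ℓ]) =
      1 + L ^ (s + 1) • (a + b) + L ^ (s + 1 + s) • (ra + rb + L • (a * b) + L ^ (s + 1) • (a * rb) +
        L ^ (s + 1) • (ra * b) + L ^ (s + 1 + s) • (ra * rb)) := by
    rw [Units.val_mul, hra, hrb]
    simp only [mul_add, add_mul, one_mul, mul_one, smul_mul_assoc, mul_smul_comm, smul_add, smul_smul]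
    module
  rw [hrc] at hprod
  have hkey : L ^ (s + 1) • (c - (a + b)) = L ^ (s + 1) • (L ^ s • (ra + rb + L • (a * b) + L ^ (s + 1) • (a * rb) +
        L ^ (s + 1) • (ra * b) + L ^ (s + 1 + s) • (ra * rb) - rc)) := by
    have h := sub_eq_zero.2 hprod
    rw [← sub_eq_zero, ← h]
    simp only [smul_sub, smul_add, smul_smul]
    module
  have hL0 : L ^ (s + 1) ≠ 0 := pow_ne_zero _ (by rw [hL]; exact_mod_cast (Fact.out : ℓ.Prime).ne_zero)
  have hcancel := smul_right_injective (Matrix (Fin 2) (Fin 2) ℤ_[ℓ]) hL0 hkey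
  intro i j
  rw [hcancel, Matrix.smul_apply, smul_eq_mul]
  exact dvd_mul_right _ _

/-- **Brackets.**  For `a, b ∈ Λₛ(G)` (`s ≥ 3`) the commutator of `exp (ℓˢ a)`, `exp (ℓˢ b)` is
`exp (ℓ^{2s} c)` with `c ∈ Λ_{2s}(G)`, `c ≡ a b − b a (mod ℓ^{s−1})`. [folklore] -/
theorem exists_mem_lattice_sub_bracket_dvd {G : Subgroup (GL (Fin 2) ℤ_[ℓ])} {s : ℕ} (hs : 3 ≤ s)
    {a b : Matrix (Fin 2) (Fin 2) ℤ_[ℓ]} (ha : a ∈ {a : Matrix (Fin 2) (Fin 2) ℤ_[ℓ] | ∃ g ∈ G,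
          (g : Matrix (Fin 2) (Fin 2) ℤ_[ℓ]).map ((↑) : ℤ_[ℓ] → ℚ_[ℓ]) =
            NormedSpace.exp ((ℓ : ℚ_[ℓ]) ^ s • a.map ((↑) : ℤ_[ℓ] → ℚ_[ℓ]))}) (hb : b ∈
                {a : Matrix (Fin 2) (Fin 2) ℤ_[ℓ] | ∃ g ∈ G,
                      (g : Matrix (Fin 2) (Fin 2) ℤ_[ℓ]).map ((↑) : ℤ_[ℓ] → ℚ_[ℓ]) =
                        NormedSpace.exp ((ℓ : ℚ_[ℓ]) ^ s • a.map ((↑) : ℤ_[ℓ] → ℚ_[ℓ]))}) :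
    ∃ c ∈ {a : Matrix (Fin 2) (Fin 2) ℤ_[ℓ] | ∃ g ∈ G,
          (g : Matrix (Fin 2) (Fin 2) ℤ_[ℓ]).map ((↑) : ℤ_[ℓ] → ℚ_[ℓ]) =
            NormedSpace.exp ((ℓ : ℚ_[ℓ]) ^ (2 * s) • a.map ((↑) : ℤ_[ℓ] → ℚ_[ℓ]))}, ∀ i j, (ℓ : ℤ_[ℓ]) ^ (s - 1) ∣ (c - (a * b - b * a)) i j := by
  obtain ⟨ga, hgaG, hga⟩ := ha
  obtain ⟨gb, hgbG, hgb⟩ := hb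
  obtain ⟨ra, hra⟩ := exists_eq_one_add_smul_add_of_map_eq_exp hs hga
  obtain ⟨rb, hrb⟩ := exists_eq_one_add_smul_add_of_map_eq_exp hs hgb
  obtain ⟨s, rfl⟩ : ∃ s', s = s' + 1 := ⟨s - 1, by omega⟩
  rw [Nat.add_sub_cancel]
  set L : ℤ_[ℓ] := (ℓ : ℤ_[ℓ]) with hL
  have h2s : 2 * (s + 1) - 1 = s + 1 + s := by omega
  rw [h2s] at hra hrb
  -- exact first-order forms
  set x : Matrix (Fin 2) (Fin 2) ℤ_[ℓ] := a + L ^ s • ra with hx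
  set y : Matrix (Fin 2) (Fin 2) ℤ_[ℓ] := b + L ^ s • rb with hy
  have hga' : (ga : Matrix (Fin 2) (Fin 2) ℤ_[ℓ]) = 1 + L ^ (s + 1) • x := by
    rw [hra, hx, smul_add, smul_smul, ← pow_add, add_assoc]
  have hgb' : (gb : Matrix (Fin 2) (Fin 2) ℤ_[ℓ]) = 1 + L ^ (s + 1) • y := by
    rw [hrb, hy, smul_add, smul_smul, ← pow_add, add_assoc]
  set k : GL (Fin 2) ℤ_[ℓ] := ga * gb * ga⁻¹ * gb⁻¹ with hk
  have hcomm := map_commutator_eq_of_le (m := s + 1) le_rfl le_rfl hga' hgb'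
  rw [← hk] at hcomm
  -- `k ∈ Γ(ℓ^{2(s+1)})`
  have hk2 : k ∈ GL2.congruenceSubgroup (p := ℓ) (2 * (s + 1)) := by
    rw [mem_congruenceSubgroup_iff_map_eq]
    have h := congrArg (Matrix.map · (ZMod.castHom (pow_dvd_pow ℓ (by omega : 2 * (s + 1) ≤ s + 1 + (s + 1) + (s + 1)))
      (ZMod (ℓ ^ (2 * (s + 1)))))) hcomm
    simp only [Matrix.map_map] at h
    have hcast : ((ZMod.castHom (pow_dvd_pow ℓ (by omega : 2 * (s + 1) ≤ s + 1 + (s + 1) + (s + 1)))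
        (ZMod (ℓ ^ (2 * (s + 1))))) ∘ (PadicInt.toZModPow (s + 1 + (s + 1) + (s + 1))) : ℤ_[ℓ] → ZMod (ℓ ^ (2 * (s + 1)))) =
        PadicInt.toZModPow (2 * (s + 1)) := by
      rw [← RingHom.coe_comp, PadicInt.zmod_cast_comp_toZModPow _ _ (by omega)]
    rw [hcast] at h
    rw [h, show s + 1 + (s + 1) = 2 * (s + 1) by ring, Matrix.map_add (PadicInt.toZModPow _) (map_add _),
      map_smul_pow_eq_zero le_rfl, add_zero, Matrix.map_one _ (map_zero _) (map_one _)]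
  obtain ⟨c, hc⟩ := exists_map_eq_exp_smul_map_of_mem (by omega) hk2
  obtain ⟨rc, hrc⟩ := exists_eq_one_add_smul_add_of_map_eq_exp (by omega) hc
  refine ⟨c, ⟨k, ?_, hc⟩, ?_⟩
  · exact G.mul_mem (G.mul_mem (G.mul_mem hgaG hgbG) (G.inv_mem hgaG)) (G.inv_mem hgbG)
  -- compare `k = 1 + ℓ^{2s+2} c + …` with the commutator congruence
  obtain ⟨e, he⟩ := exists_eq_add_smul_of_map_eq hcomm
  rw [hrc] at he
  have h4 : 2 * (2 * (s + 1)) - 1 = 2 * (s + 1) + (2 * s + 1) := by omega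
  rw [h4, show s + 1 + (s + 1) = 2 * (s + 1) by ring] at he
  have hkey : L ^ (2 * (s + 1)) • (c - (x * y - y * x)) =
      L ^ (2 * (s + 1)) • (L ^ (s + 1) • e - L ^ (2 * s + 1) • rc) := by
    have h := sub_eq_zero.2 he
    rw [← sub_eq_zero, ← h]
    simp only [smul_sub, smul_smul, ← pow_add]
    module
  have hL0 : L ^ (2 * (s + 1)) ≠ 0 := pow_ne_zero _ (by rw [hL]; exact_mod_cast (Fact.out : ℓ.Prime).ne_zero)
  have hcancel := smul_right_injective (Matrix (Fin 2) (Fin 2) ℤ_[ℓ]) hL0 hkey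
  have hcxy : c - (a * b - b * a) = L ^ s • (L • e - L ^ (s + 1) • rc + (a * rb - rb * a) + (ra * b - b * ra) +
      L ^ s • (ra * rb - rb * ra)) := by
    have : c = (x * y - y * x) + (L ^ (s + 1) • e - L ^ (2 * s + 1) • rc) := by rw [← hcancel]; abel
    rw [this, hx, hy]
    simp only [mul_add, add_mul, smul_mul_assoc, mul_smul_comm, smul_add, smul_sub, smul_smul, ← pow_add,
      ← pow_succ]
    module
  intro i j
  rw [hcxy, Matrix.smul_apply, smul_eq_mul]
  exact dvd_mul_right _ _

/-! ### The Lie lattice `Λ∞(G)`: a saturated `ℤ_ℓ`-Lie subring of `M₂(ℤ_ℓ)` -/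

/-- `Λₛ(G) ⊆ Λ∞(G)` for `s ≥ 3`. [folklore] -/
theorem lattice_subset_latticeInfty (G : Subgroup (GL (Fin 2) ℤ_[ℓ])) {s : ℕ} (hs : 3 ≤ s) :
    {a : Matrix (Fin 2) (Fin 2) ℤ_[ℓ] | ∃ g ∈ G,
          (g : Matrix (Fin 2) (Fin 2) ℤ_[ℓ]).map ((↑) : ℤ_[ℓ] → ℚ_[ℓ]) =
            NormedSpace.exp ((ℓ : ℚ_[ℓ]) ^ s • a.map ((↑) : ℤ_[ℓ] → ℚ_[ℓ]))} ⊆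
                closure (⋃ n : ℕ, {a : Matrix (Fin 2) (Fin 2) ℤ_[ℓ] | ∃ g ∈ G,
                      (g : Matrix (Fin 2) (Fin 2) ℤ_[ℓ]).map ((↑) : ℤ_[ℓ] → ℚ_[ℓ]) =
                        NormedSpace.exp ((ℓ : ℚ_[ℓ]) ^ (n + 3) • a.map ((↑) : ℤ_[ℓ] → ℚ_[ℓ]))}) := by
  intro a ha
  refine subset_closure (Set.mem_iUnion.2 ⟨s - 3, ?_⟩)
  rw [Nat.sub_add_cancel hs]
  exact ha

/-- A sequence in `M₂(ℤ_ℓ)` congruent to `y` modulo `ℓᵗ` at stage `t` converges to `y`.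
[folklore] -/
theorem tendsto_of_forall_dvd_sub {x : ℕ → Matrix (Fin 2) (Fin 2) ℤ_[ℓ]} {y : Matrix (Fin 2) (Fin 2) ℤ_[ℓ]}
    (h : ∀ t, ∀ i j, (ℓ : ℤ_[ℓ]) ^ t ∣ (x t - y) i j) : Tendsto x atTop (𝓝 y) := by
  have hℓ : (1 : ℝ) < ℓ := by exact_mod_cast (Fact.out : ℓ.Prime).one_lt
  refine tendsto_pi_nhds.2 fun i ↦ tendsto_pi_nhds.2 fun j ↦ ?_
  rw [tendsto_iff_norm_sub_tendsto_zero]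
  have hb : ∀ t, ‖x t i j - y i j‖ ≤ ((ℓ : ℝ)⁻¹) ^ t := by
    intro t
    rw [← Matrix.sub_apply, inv_pow, ← zpow_natCast, ← _root_.zpow_neg, PadicInt.norm_le_pow_iff_mem_span_pow,
      Ideal.mem_span_singleton]
    exact h t i j
  exact squeeze_zero (fun t ↦ norm_nonneg _) hb
    (tendsto_pow_atTop_nhds_zero_of_lt_one (inv_nonneg.2 (by positivity)) (inv_lt_one_of_one_lt₀ hℓ))

/-- **Limit criterion.**  If `y` is congruent modulo every `ℓᵗ` to an element of some `Λₛ(G)`,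
`s ≥ 3`, then `y ∈ Λ∞(G)`. [folklore] -/
theorem mem_latticeInfty_of_forall_exists {G : Subgroup (GL (Fin 2) ℤ_[ℓ])} {y : Matrix (Fin 2) (Fin 2) ℤ_[ℓ]}
    (h : ∀ t : ℕ, ∃ s, 3 ≤ s ∧ ∃ c ∈ {a : Matrix (Fin 2) (Fin 2) ℤ_[ℓ] | ∃ g ∈ G,
          (g : Matrix (Fin 2) (Fin 2) ℤ_[ℓ]).map ((↑) : ℤ_[ℓ] → ℚ_[ℓ]) =
            NormedSpace.exp ((ℓ : ℚ_[ℓ]) ^ s • a.map ((↑) : ℤ_[ℓ] → ℚ_[ℓ]))}, ∀ i j, (ℓ : ℤ_[ℓ]) ^ t ∣ (c - y) i j) : y ∈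
                closure (⋃ n : ℕ, {a : Matrix (Fin 2) (Fin 2) ℤ_[ℓ] | ∃ g ∈ G,
                      (g : Matrix (Fin 2) (Fin 2) ℤ_[ℓ]).map ((↑) : ℤ_[ℓ] → ℚ_[ℓ]) =
                        NormedSpace.exp ((ℓ : ℚ_[ℓ]) ^ (n + 3) • a.map ((↑) : ℤ_[ℓ] → ℚ_[ℓ]))}) := by
  choose s hs c hc hcy using h
  refine mem_closure_of_tendsto (tendsto_of_forall_dvd_sub hcy) (Eventually.of_forall fun t ↦ ?_)
  exact Set.mem_iUnion.2 ⟨s t - 3, by rw [Nat.sub_add_cancel (hs t)]; exact hc t⟩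

/-- Elements of `⋃ₛ Λₛ(G)` lie in a common `Λₜ(G)` for all large `t`. [folklore] -/
theorem exists_forall_mem_lattice_of_mem_iUnion {G : Subgroup (GL (Fin 2) ℤ_[ℓ])}
    {a b : Matrix (Fin 2) (Fin 2) ℤ_[ℓ]} (ha : a ∈ ⋃ n : ℕ, {a : Matrix (Fin 2) (Fin 2) ℤ_[ℓ] | ∃ g ∈ G,
          (g : Matrix (Fin 2) (Fin 2) ℤ_[ℓ]).map ((↑) : ℤ_[ℓ] → ℚ_[ℓ]) =
            NormedSpace.exp ((ℓ : ℚ_[ℓ]) ^ (n + 3) • a.map ((↑) : ℤ_[ℓ] → ℚ_[ℓ]))}) (hb : b ∈ ⋃ n : ℕ,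
                {a : Matrix (Fin 2) (Fin 2) ℤ_[ℓ] | ∃ g ∈ G,
                      (g : Matrix (Fin 2) (Fin 2) ℤ_[ℓ]).map ((↑) : ℤ_[ℓ] → ℚ_[ℓ]) =
                        NormedSpace.exp ((ℓ : ℚ_[ℓ]) ^ (n + 3) • a.map ((↑) : ℤ_[ℓ] → ℚ_[ℓ]))}) :
    ∃ t₀, 3 ≤ t₀ ∧ ∀ t, t₀ ≤ t → a ∈ {a : Matrix (Fin 2) (Fin 2) ℤ_[ℓ] | ∃ g ∈ G,
          (g : Matrix (Fin 2) (Fin 2) ℤ_[ℓ]).map ((↑) : ℤ_[ℓ] → ℚ_[ℓ]) =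
            NormedSpace.exp ((ℓ : ℚ_[ℓ]) ^ t • a.map ((↑) : ℤ_[ℓ] → ℚ_[ℓ]))} ∧ b ∈
                {a : Matrix (Fin 2) (Fin 2) ℤ_[ℓ] | ∃ g ∈ G,
                      (g : Matrix (Fin 2) (Fin 2) ℤ_[ℓ]).map ((↑) : ℤ_[ℓ] → ℚ_[ℓ]) =
                        NormedSpace.exp ((ℓ : ℚ_[ℓ]) ^ t • a.map ((↑) : ℤ_[ℓ] → ℚ_[ℓ]))} := by
  obtain ⟨m, hm⟩ := Set.mem_iUnion.1 ha
  obtain ⟨n, hn⟩ := Set.mem_iUnion.1 hb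
  refine ⟨max m n + 3, by omega, fun t ht ↦ ⟨?_, ?_⟩⟩
  · exact mem_lattice_of_le (by omega) (by omega) hm
  · exact mem_lattice_of_le (by omega) (by omega) hn

/-- `0 ∈ Λ∞(G)`. [folklore] -/
theorem zero_mem_latticeInfty (G : Subgroup (GL (Fin 2) ℤ_[ℓ])) : (0 : Matrix (Fin 2) (Fin 2) ℤ_[ℓ]) ∈
    closure (⋃ n : ℕ, {a : Matrix (Fin 2) (Fin 2) ℤ_[ℓ] | ∃ g ∈ G,
          (g : Matrix (Fin 2) (Fin 2) ℤ_[ℓ]).map ((↑) : ℤ_[ℓ] → ℚ_[ℓ]) =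
            NormedSpace.exp ((ℓ : ℚ_[ℓ]) ^ (n + 3) • a.map ((↑) : ℤ_[ℓ] → ℚ_[ℓ]))}) :=
  lattice_subset_latticeInfty G le_rfl (zero_mem_lattice G 3)

/-- **`Λ∞(G)` is closed under addition** (`exp (ℓˢ a) exp (ℓˢ b) = exp (ℓˢ c)` with
`c ≡ a + b (mod ℓ^{s−1})`, and `s → ∞`). [folklore] -/
theorem add_mem_latticeInfty {G : Subgroup (GL (Fin 2) ℤ_[ℓ])} {a b : Matrix (Fin 2) (Fin 2) ℤ_[ℓ]}
    (ha : a ∈ closure (⋃ n : ℕ, {a : Matrix (Fin 2) (Fin 2) ℤ_[ℓ] | ∃ g ∈ G,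
          (g : Matrix (Fin 2) (Fin 2) ℤ_[ℓ]).map ((↑) : ℤ_[ℓ] → ℚ_[ℓ]) =
            NormedSpace.exp ((ℓ : ℚ_[ℓ]) ^ (n + 3) • a.map ((↑) : ℤ_[ℓ] → ℚ_[ℓ]))})) (hb : b ∈
                closure (⋃ n : ℕ, {a : Matrix (Fin 2) (Fin 2) ℤ_[ℓ] | ∃ g ∈ G,
                      (g : Matrix (Fin 2) (Fin 2) ℤ_[ℓ]).map ((↑) : ℤ_[ℓ] → ℚ_[ℓ]) =
                        NormedSpace.exp ((ℓ : ℚ_[ℓ]) ^ (n + 3) • a.map ((↑) : ℤ_[ℓ] → ℚ_[ℓ]))})) : a + b ∈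
                            closure (⋃ n : ℕ, {a : Matrix (Fin 2) (Fin 2) ℤ_[ℓ] | ∃ g ∈ G,
                                  (g : Matrix (Fin 2) (Fin 2) ℤ_[ℓ]).map ((↑) : ℤ_[ℓ] → ℚ_[ℓ]) =
                                    NormedSpace.exp ((ℓ : ℚ_[ℓ]) ^ (n + 3) • a.map ((↑) : ℤ_[ℓ] → ℚ_[ℓ]))}) := by
  -- first for `a, b` in the union
  have key : ∀ a ∈ ⋃ n : ℕ, {a : Matrix (Fin 2) (Fin 2) ℤ_[ℓ] | ∃ g ∈ G,
        (g : Matrix (Fin 2) (Fin 2) ℤ_[ℓ]).map ((↑) : ℤ_[ℓ] → ℚ_[ℓ]) =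
          NormedSpace.exp ((ℓ : ℚ_[ℓ]) ^ (n + 3) • a.map ((↑) : ℤ_[ℓ] → ℚ_[ℓ]))}, ∀ b ∈ ⋃ n : ℕ,
              {a : Matrix (Fin 2) (Fin 2) ℤ_[ℓ] | ∃ g ∈ G,
                    (g : Matrix (Fin 2) (Fin 2) ℤ_[ℓ]).map ((↑) : ℤ_[ℓ] → ℚ_[ℓ]) =
                      NormedSpace.exp ((ℓ : ℚ_[ℓ]) ^ (n + 3) • a.map ((↑) : ℤ_[ℓ] → ℚ_[ℓ]))}, a + b ∈
                          closure (⋃ n : ℕ, {a : Matrix (Fin 2) (Fin 2) ℤ_[ℓ] | ∃ g ∈ G,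
                                (g : Matrix (Fin 2) (Fin 2) ℤ_[ℓ]).map ((↑) : ℤ_[ℓ] → ℚ_[ℓ]) =
                                  NormedSpace.exp ((ℓ : ℚ_[ℓ]) ^ (n + 3) • a.map ((↑) : ℤ_[ℓ] → ℚ_[ℓ]))}) := by
    intro a ha b hb
    obtain ⟨t₀, ht₀, hmem⟩ := exists_forall_mem_lattice_of_mem_iUnion ha hb
    refine mem_latticeInfty_of_forall_exists fun t ↦ ⟨t₀ + t + 1, by omega, ?_⟩
    obtain ⟨c, hc, hcab⟩ := exists_mem_lattice_sub_add_dvd (s := t₀ + t + 1) (by omega)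
      (hmem (t₀ + t + 1) (by omega)).1 (hmem (t₀ + t + 1) (by omega)).2
    exact ⟨c, hc, fun i j ↦ (pow_dvd_pow _ (by omega)).trans (hcab i j)⟩
  -- then pass to the closure, one variable at a time
  have step : ∀ b ∈ ⋃ n : ℕ, {a : Matrix (Fin 2) (Fin 2) ℤ_[ℓ] | ∃ g ∈ G,
        (g : Matrix (Fin 2) (Fin 2) ℤ_[ℓ]).map ((↑) : ℤ_[ℓ] → ℚ_[ℓ]) =
          NormedSpace.exp ((ℓ : ℚ_[ℓ]) ^ (n + 3) • a.map ((↑) : ℤ_[ℓ] → ℚ_[ℓ]))}, ∀ a ∈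
              closure (⋃ n : ℕ, {a : Matrix (Fin 2) (Fin 2) ℤ_[ℓ] | ∃ g ∈ G,
                    (g : Matrix (Fin 2) (Fin 2) ℤ_[ℓ]).map ((↑) : ℤ_[ℓ] → ℚ_[ℓ]) =
                      NormedSpace.exp ((ℓ : ℚ_[ℓ]) ^ (n + 3) • a.map ((↑) : ℤ_[ℓ] → ℚ_[ℓ]))}), a + b ∈
                          closure (⋃ n : ℕ, {a : Matrix (Fin 2) (Fin 2) ℤ_[ℓ] | ∃ g ∈ G,
                                (g : Matrix (Fin 2) (Fin 2) ℤ_[ℓ]).map ((↑) : ℤ_[ℓ] → ℚ_[ℓ]) =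
                                  NormedSpace.exp ((ℓ : ℚ_[ℓ]) ^ (n + 3) • a.map ((↑) : ℤ_[ℓ] → ℚ_[ℓ]))}) := by
    intro b hb a ha
    have hcl : IsClosed {a : Matrix (Fin 2) (Fin 2) ℤ_[ℓ] | a + b ∈
        closure (⋃ n : ℕ, {a : Matrix (Fin 2) (Fin 2) ℤ_[ℓ] | ∃ g ∈ G,
              (g : Matrix (Fin 2) (Fin 2) ℤ_[ℓ]).map ((↑) : ℤ_[ℓ] → ℚ_[ℓ]) =
                NormedSpace.exp ((ℓ : ℚ_[ℓ]) ^ (n + 3) • a.map ((↑) : ℤ_[ℓ] → ℚ_[ℓ]))})} :=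
      isClosed_closure.preimage (continuous_id.add continuous_const)
    exact (hcl.closure_subset_iff.2 fun a ha ↦ key a ha b hb) ha
  have hcl : IsClosed {b : Matrix (Fin 2) (Fin 2) ℤ_[ℓ] | a + b ∈
      closure (⋃ n : ℕ, {a : Matrix (Fin 2) (Fin 2) ℤ_[ℓ] | ∃ g ∈ G,
            (g : Matrix (Fin 2) (Fin 2) ℤ_[ℓ]).map ((↑) : ℤ_[ℓ] → ℚ_[ℓ]) =
              NormedSpace.exp ((ℓ : ℚ_[ℓ]) ^ (n + 3) • a.map ((↑) : ℤ_[ℓ] → ℚ_[ℓ]))})} :=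
    isClosed_closure.preimage (continuous_const.add continuous_id)
  exact (hcl.closure_subset_iff.2 fun b hb ↦ step b hb a ha) hb

/-- **`Λ∞(G)` is a `ℤ_ℓ`-module** (naturals act by powers in `G`; `ℕ` is dense in `ℤ_ℓ`).
[folklore] -/
theorem smul_mem_latticeInfty {G : Subgroup (GL (Fin 2) ℤ_[ℓ])} {a : Matrix (Fin 2) (Fin 2) ℤ_[ℓ]}
    (ha : a ∈ closure (⋃ n : ℕ, {a : Matrix (Fin 2) (Fin 2) ℤ_[ℓ] | ∃ g ∈ G,
          (g : Matrix (Fin 2) (Fin 2) ℤ_[ℓ]).map ((↑) : ℤ_[ℓ] → ℚ_[ℓ]) =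
            NormedSpace.exp ((ℓ : ℚ_[ℓ]) ^ (n + 3) • a.map ((↑) : ℤ_[ℓ] → ℚ_[ℓ]))})) (c : ℤ_[ℓ]) : c • a ∈
                closure (⋃ n : ℕ, {a : Matrix (Fin 2) (Fin 2) ℤ_[ℓ] | ∃ g ∈ G,
                      (g : Matrix (Fin 2) (Fin 2) ℤ_[ℓ]).map ((↑) : ℤ_[ℓ] → ℚ_[ℓ]) =
                        NormedSpace.exp ((ℓ : ℚ_[ℓ]) ^ (n + 3) • a.map ((↑) : ℤ_[ℓ] → ℚ_[ℓ]))}) := by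
  have key : ∀ a ∈ ⋃ n : ℕ, {a : Matrix (Fin 2) (Fin 2) ℤ_[ℓ] | ∃ g ∈ G,
        (g : Matrix (Fin 2) (Fin 2) ℤ_[ℓ]).map ((↑) : ℤ_[ℓ] → ℚ_[ℓ]) =
          NormedSpace.exp ((ℓ : ℚ_[ℓ]) ^ (n + 3) • a.map ((↑) : ℤ_[ℓ] → ℚ_[ℓ]))}, c • a ∈
              closure (⋃ n : ℕ, {a : Matrix (Fin 2) (Fin 2) ℤ_[ℓ] | ∃ g ∈ G,
                    (g : Matrix (Fin 2) (Fin 2) ℤ_[ℓ]).map ((↑) : ℤ_[ℓ] → ℚ_[ℓ]) =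
                      NormedSpace.exp ((ℓ : ℚ_[ℓ]) ^ (n + 3) • a.map ((↑) : ℤ_[ℓ] → ℚ_[ℓ]))}) := by
    intro a ha
    obtain ⟨n, hn⟩ := Set.mem_iUnion.1 ha
    have hcont : Continuous (fun c : ℤ_[ℓ] ↦ c • a) := continuous_id.smul continuous_const
    have hcl : IsClosed {c : ℤ_[ℓ] | c • a ∈ closure (⋃ n : ℕ, {a : Matrix (Fin 2) (Fin 2) ℤ_[ℓ] | ∃ g ∈ G,
          (g : Matrix (Fin 2) (Fin 2) ℤ_[ℓ]).map ((↑) : ℤ_[ℓ] → ℚ_[ℓ]) =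
            NormedSpace.exp ((ℓ : ℚ_[ℓ]) ^ (n + 3) • a.map ((↑) : ℤ_[ℓ] → ℚ_[ℓ]))})} := isClosed_closure.preimage hcont
    refine PadicInt.denseRange_natCast.induction_on c hcl fun k ↦ ?_
    show ((k : ℤ_[ℓ]) • a) ∈ closure (⋃ n : ℕ, {a : Matrix (Fin 2) (Fin 2) ℤ_[ℓ] | ∃ g ∈ G,
          (g : Matrix (Fin 2) (Fin 2) ℤ_[ℓ]).map ((↑) : ℤ_[ℓ] → ℚ_[ℓ]) =
            NormedSpace.exp ((ℓ : ℚ_[ℓ]) ^ (n + 3) • a.map ((↑) : ℤ_[ℓ] → ℚ_[ℓ]))})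
    rw [Nat.cast_smul_eq_nsmul]
    exact lattice_subset_latticeInfty G (by omega) (nsmul_mem_lattice (by omega) hn k)
  have hcl : IsClosed {a : Matrix (Fin 2) (Fin 2) ℤ_[ℓ] | c • a ∈
      closure (⋃ n : ℕ, {a : Matrix (Fin 2) (Fin 2) ℤ_[ℓ] | ∃ g ∈ G,
            (g : Matrix (Fin 2) (Fin 2) ℤ_[ℓ]).map ((↑) : ℤ_[ℓ] → ℚ_[ℓ]) =
              NormedSpace.exp ((ℓ : ℚ_[ℓ]) ^ (n + 3) • a.map ((↑) : ℤ_[ℓ] → ℚ_[ℓ]))})} :=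
    isClosed_closure.preimage (continuous_const_smul c)
  exact (hcl.closure_subset_iff.2 key) ha

/-- `Λ∞(G)` is closed under negation. [folklore] -/
theorem neg_mem_latticeInfty {G : Subgroup (GL (Fin 2) ℤ_[ℓ])} {a : Matrix (Fin 2) (Fin 2) ℤ_[ℓ]}
    (ha : a ∈ closure (⋃ n : ℕ, {a : Matrix (Fin 2) (Fin 2) ℤ_[ℓ] | ∃ g ∈ G,
          (g : Matrix (Fin 2) (Fin 2) ℤ_[ℓ]).map ((↑) : ℤ_[ℓ] → ℚ_[ℓ]) =
            NormedSpace.exp ((ℓ : ℚ_[ℓ]) ^ (n + 3) • a.map ((↑) : ℤ_[ℓ] → ℚ_[ℓ]))})) : -a ∈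
                closure (⋃ n : ℕ, {a : Matrix (Fin 2) (Fin 2) ℤ_[ℓ] | ∃ g ∈ G,
                      (g : Matrix (Fin 2) (Fin 2) ℤ_[ℓ]).map ((↑) : ℤ_[ℓ] → ℚ_[ℓ]) =
                        NormedSpace.exp ((ℓ : ℚ_[ℓ]) ^ (n + 3) • a.map ((↑) : ℤ_[ℓ] → ℚ_[ℓ]))}) := by
  have h := smul_mem_latticeInfty ha (-1)
  rwa [neg_one_smul] at h

/-- `Λ∞(G)` is closed under subtraction. [folklore] -/
theorem sub_mem_latticeInfty {G : Subgroup (GL (Fin 2) ℤ_[ℓ])} {a b : Matrix (Fin 2) (Fin 2) ℤ_[ℓ]}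
    (ha : a ∈ closure (⋃ n : ℕ, {a : Matrix (Fin 2) (Fin 2) ℤ_[ℓ] | ∃ g ∈ G,
          (g : Matrix (Fin 2) (Fin 2) ℤ_[ℓ]).map ((↑) : ℤ_[ℓ] → ℚ_[ℓ]) =
            NormedSpace.exp ((ℓ : ℚ_[ℓ]) ^ (n + 3) • a.map ((↑) : ℤ_[ℓ] → ℚ_[ℓ]))})) (hb : b ∈
                closure (⋃ n : ℕ, {a : Matrix (Fin 2) (Fin 2) ℤ_[ℓ] | ∃ g ∈ G,
                      (g : Matrix (Fin 2) (Fin 2) ℤ_[ℓ]).map ((↑) : ℤ_[ℓ] → ℚ_[ℓ]) =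
                        NormedSpace.exp ((ℓ : ℚ_[ℓ]) ^ (n + 3) • a.map ((↑) : ℤ_[ℓ] → ℚ_[ℓ]))})) : a - b ∈
                            closure (⋃ n : ℕ, {a : Matrix (Fin 2) (Fin 2) ℤ_[ℓ] | ∃ g ∈ G,
                                  (g : Matrix (Fin 2) (Fin 2) ℤ_[ℓ]).map ((↑) : ℤ_[ℓ] → ℚ_[ℓ]) =
                                    NormedSpace.exp ((ℓ : ℚ_[ℓ]) ^ (n + 3) • a.map ((↑) : ℤ_[ℓ] → ℚ_[ℓ]))}) := by
  rw [sub_eq_add_neg]; exact add_mem_latticeInfty ha (neg_mem_latticeInfty hb)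

/-- **`Λ∞(G)` is closed under the bracket** `[a, b] = a b − b a` (commutators in `G` are graded
brackets). [folklore] -/
theorem bracket_mem_latticeInfty {G : Subgroup (GL (Fin 2) ℤ_[ℓ])} {a b : Matrix (Fin 2) (Fin 2) ℤ_[ℓ]}
    (ha : a ∈ closure (⋃ n : ℕ, {a : Matrix (Fin 2) (Fin 2) ℤ_[ℓ] | ∃ g ∈ G,
          (g : Matrix (Fin 2) (Fin 2) ℤ_[ℓ]).map ((↑) : ℤ_[ℓ] → ℚ_[ℓ]) =
            NormedSpace.exp ((ℓ : ℚ_[ℓ]) ^ (n + 3) • a.map ((↑) : ℤ_[ℓ] → ℚ_[ℓ]))})) (hb : b ∈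
                closure (⋃ n : ℕ, {a : Matrix (Fin 2) (Fin 2) ℤ_[ℓ] | ∃ g ∈ G,
                      (g : Matrix (Fin 2) (Fin 2) ℤ_[ℓ]).map ((↑) : ℤ_[ℓ] → ℚ_[ℓ]) =
                        NormedSpace.exp ((ℓ : ℚ_[ℓ]) ^ (n + 3) • a.map ((↑) : ℤ_[ℓ] → ℚ_[ℓ]))})) : a * b - b * a ∈
                            closure (⋃ n : ℕ, {a : Matrix (Fin 2) (Fin 2) ℤ_[ℓ] | ∃ g ∈ G,
                                  (g : Matrix (Fin 2) (Fin 2) ℤ_[ℓ]).map ((↑) : ℤ_[ℓ] → ℚ_[ℓ]) =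
                                    NormedSpace.exp ((ℓ : ℚ_[ℓ]) ^ (n + 3) • a.map ((↑) : ℤ_[ℓ] → ℚ_[ℓ]))}) := by
  have key : ∀ a ∈ ⋃ n : ℕ, {a : Matrix (Fin 2) (Fin 2) ℤ_[ℓ] | ∃ g ∈ G,
        (g : Matrix (Fin 2) (Fin 2) ℤ_[ℓ]).map ((↑) : ℤ_[ℓ] → ℚ_[ℓ]) =
          NormedSpace.exp ((ℓ : ℚ_[ℓ]) ^ (n + 3) • a.map ((↑) : ℤ_[ℓ] → ℚ_[ℓ]))}, ∀ b ∈ ⋃ n : ℕ,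
              {a : Matrix (Fin 2) (Fin 2) ℤ_[ℓ] | ∃ g ∈ G,
                    (g : Matrix (Fin 2) (Fin 2) ℤ_[ℓ]).map ((↑) : ℤ_[ℓ] → ℚ_[ℓ]) =
                      NormedSpace.exp ((ℓ : ℚ_[ℓ]) ^ (n + 3) • a.map ((↑) : ℤ_[ℓ] → ℚ_[ℓ]))}, a * b - b * a ∈
                          closure (⋃ n : ℕ, {a : Matrix (Fin 2) (Fin 2) ℤ_[ℓ] | ∃ g ∈ G,
                                (g : Matrix (Fin 2) (Fin 2) ℤ_[ℓ]).map ((↑) : ℤ_[ℓ] → ℚ_[ℓ]) =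
                                  NormedSpace.exp ((ℓ : ℚ_[ℓ]) ^ (n + 3) • a.map ((↑) : ℤ_[ℓ] → ℚ_[ℓ]))}) := by
    intro a ha b hb
    obtain ⟨t₀, ht₀, hmem⟩ := exists_forall_mem_lattice_of_mem_iUnion ha hb
    refine mem_latticeInfty_of_forall_exists fun t ↦ ⟨2 * (t₀ + t + 1), by omega, ?_⟩
    obtain ⟨c, hc, hcab⟩ := exists_mem_lattice_sub_bracket_dvd (s := t₀ + t + 1) (by omega)
      (hmem (t₀ + t + 1) (by omega)).1 (hmem (t₀ + t + 1) (by omega)).2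
    exact ⟨c, hc, fun i j ↦ (pow_dvd_pow _ (by omega)).trans (hcab i j)⟩
  have step : ∀ b ∈ ⋃ n : ℕ, {a : Matrix (Fin 2) (Fin 2) ℤ_[ℓ] | ∃ g ∈ G,
        (g : Matrix (Fin 2) (Fin 2) ℤ_[ℓ]).map ((↑) : ℤ_[ℓ] → ℚ_[ℓ]) =
          NormedSpace.exp ((ℓ : ℚ_[ℓ]) ^ (n + 3) • a.map ((↑) : ℤ_[ℓ] → ℚ_[ℓ]))}, ∀ a ∈
              closure (⋃ n : ℕ, {a : Matrix (Fin 2) (Fin 2) ℤ_[ℓ] | ∃ g ∈ G,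
                    (g : Matrix (Fin 2) (Fin 2) ℤ_[ℓ]).map ((↑) : ℤ_[ℓ] → ℚ_[ℓ]) =
                      NormedSpace.exp ((ℓ : ℚ_[ℓ]) ^ (n + 3) • a.map ((↑) : ℤ_[ℓ] → ℚ_[ℓ]))}), a * b - b * a ∈
                          closure (⋃ n : ℕ, {a : Matrix (Fin 2) (Fin 2) ℤ_[ℓ] | ∃ g ∈ G,
                                (g : Matrix (Fin 2) (Fin 2) ℤ_[ℓ]).map ((↑) : ℤ_[ℓ] → ℚ_[ℓ]) =
                                  NormedSpace.exp ((ℓ : ℚ_[ℓ]) ^ (n + 3) • a.map ((↑) : ℤ_[ℓ] → ℚ_[ℓ]))}) := by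
    intro b hb a ha
    have hcl : IsClosed {a : Matrix (Fin 2) (Fin 2) ℤ_[ℓ] | a * b - b * a ∈
        closure (⋃ n : ℕ, {a : Matrix (Fin 2) (Fin 2) ℤ_[ℓ] | ∃ g ∈ G,
              (g : Matrix (Fin 2) (Fin 2) ℤ_[ℓ]).map ((↑) : ℤ_[ℓ] → ℚ_[ℓ]) =
                NormedSpace.exp ((ℓ : ℚ_[ℓ]) ^ (n + 3) • a.map ((↑) : ℤ_[ℓ] → ℚ_[ℓ]))})} :=
      isClosed_closure.preimage ((continuous_id.mul continuous_const).sub (continuous_const.mul continuous_id))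
    exact (hcl.closure_subset_iff.2 fun a ha ↦ key a ha b hb) ha
  have hcl : IsClosed {b : Matrix (Fin 2) (Fin 2) ℤ_[ℓ] | a * b - b * a ∈
      closure (⋃ n : ℕ, {a : Matrix (Fin 2) (Fin 2) ℤ_[ℓ] | ∃ g ∈ G,
            (g : Matrix (Fin 2) (Fin 2) ℤ_[ℓ]).map ((↑) : ℤ_[ℓ] → ℚ_[ℓ]) =
              NormedSpace.exp ((ℓ : ℚ_[ℓ]) ^ (n + 3) • a.map ((↑) : ℤ_[ℓ] → ℚ_[ℓ]))})} :=
    isClosed_closure.preimage ((continuous_const.mul continuous_id).sub (continuous_id.mul continuous_const))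
  exact (hcl.closure_subset_iff.2 fun b hb ↦ step b hb a ha) hb

/-- Points of the closure of a set of integral matrices are congruent to points of the set modulo
any `ℓᴺ`. [folklore] -/
theorem exists_dvd_sub_of_mem_closure {S : Set (Matrix (Fin 2) (Fin 2) ℤ_[ℓ])} {y : Matrix (Fin 2) (Fin 2) ℤ_[ℓ]}
    (hy : y ∈ closure S) (N : ℕ) : ∃ u ∈ S, ∀ i j, (ℓ : ℤ_[ℓ]) ^ N ∣ (u - y) i j := by
  have hr : (ℓ : ℝ) ^ (-(N : ℤ)) ≠ 0 := zpow_ne_zero _ (by exact_mod_cast (Fact.out : ℓ.Prime).ne_zero)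
  set V : Set (Matrix (Fin 2) (Fin 2) ℤ_[ℓ]) :=
    (fun u ↦ u - y) ⁻¹' (Metric.closedBall (0 : ℤ_[ℓ]) ((ℓ : ℝ) ^ (-(N : ℤ)))).matrix with hV
  have hVo : IsOpen V := ((IsUltrametricDist.isOpen_closedBall (0 : ℤ_[ℓ]) hr).matrix).preimage
    (continuous_id.sub continuous_const)
  have hyV : y ∈ V := by
    simp only [hV, Set.mem_preimage, sub_self, Set.mem_matrix, Matrix.zero_apply, Metric.mem_closedBall,
      dist_self]
    intro i j; positivity
  obtain ⟨u, huV, huS⟩ := (mem_closure_iff.1 hy V hVo hyV)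
  refine ⟨u, huS, fun i j ↦ ?_⟩
  have h := huV
  simp only [hV, Set.mem_preimage, Set.mem_matrix, mem_closedBall_zero_iff] at h
  rw [← Ideal.mem_span_singleton, ← PadicInt.norm_le_pow_iff_mem_span_pow]
  exact h i j

/-- **`Λ∞(G)` is saturated**: `ℓ • x ∈ Λ∞(G)` implies `x ∈ Λ∞(G)` (if `exp (ℓˢ u) ∈ G` with
`u = ℓ u'` then `u' ∈ Λ_{s+1}(G)`). [folklore] -/
theorem mem_latticeInfty_of_smul_mem {G : Subgroup (GL (Fin 2) ℤ_[ℓ])} {x : Matrix (Fin 2) (Fin 2) ℤ_[ℓ]}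
    (hx : (ℓ : ℤ_[ℓ]) • x ∈ closure (⋃ n : ℕ, {a : Matrix (Fin 2) (Fin 2) ℤ_[ℓ] | ∃ g ∈ G,
          (g : Matrix (Fin 2) (Fin 2) ℤ_[ℓ]).map ((↑) : ℤ_[ℓ] → ℚ_[ℓ]) =
            NormedSpace.exp ((ℓ : ℚ_[ℓ]) ^ (n + 3) • a.map ((↑) : ℤ_[ℓ] → ℚ_[ℓ]))})) : x ∈
                closure (⋃ n : ℕ, {a : Matrix (Fin 2) (Fin 2) ℤ_[ℓ] | ∃ g ∈ G,
                      (g : Matrix (Fin 2) (Fin 2) ℤ_[ℓ]).map ((↑) : ℤ_[ℓ] → ℚ_[ℓ]) =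
                        NormedSpace.exp ((ℓ : ℚ_[ℓ]) ^ (n + 3) • a.map ((↑) : ℤ_[ℓ] → ℚ_[ℓ]))}) := by
  refine mem_latticeInfty_of_forall_exists fun N ↦ ?_
  obtain ⟨u, hu, huN⟩ := exists_dvd_sub_of_mem_closure hx (N + 1)
  obtain ⟨n, hn⟩ := Set.mem_iUnion.1 hu
  -- `u = ℓ • (x + ℓ^N • e)`
  have hmap : u.map (PadicInt.toZModPow (N + 1)) = ((ℓ : ℤ_[ℓ]) • x).map (PadicInt.toZModPow (N + 1)) :=
    (map_toZModPow_eq_iff (N + 1) _ _).2 huN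
  obtain ⟨e, he⟩ := exists_eq_add_smul_of_map_eq hmap
  have hu' : u = (ℓ : ℤ_[ℓ]) • (x + (ℓ : ℤ_[ℓ]) ^ N • e) := by
    rw [he, smul_add, smul_smul, ← pow_succ']
  rw [hu'] at hn
  refine ⟨n + 3 + 1, by omega, x + (ℓ : ℤ_[ℓ]) ^ N • e, mem_lattice_succ_of_smul_mem hn, fun i j ↦ ?_⟩
  rw [add_sub_cancel_left, Matrix.smul_apply, smul_eq_mul]
  exact dvd_mul_right _ _

/-- Saturation for powers: `ℓᵐ • x ∈ Λ∞(G)` implies `x ∈ Λ∞(G)`. [folklore] -/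
theorem mem_latticeInfty_of_pow_smul_mem {G : Subgroup (GL (Fin 2) ℤ_[ℓ])} {x : Matrix (Fin 2) (Fin 2) ℤ_[ℓ]}
    {m : ℕ} (hx : (ℓ : ℤ_[ℓ]) ^ m • x ∈ closure (⋃ n : ℕ, {a : Matrix (Fin 2) (Fin 2) ℤ_[ℓ] | ∃ g ∈ G,
          (g : Matrix (Fin 2) (Fin 2) ℤ_[ℓ]).map ((↑) : ℤ_[ℓ] → ℚ_[ℓ]) =
            NormedSpace.exp ((ℓ : ℚ_[ℓ]) ^ (n + 3) • a.map ((↑) : ℤ_[ℓ] → ℚ_[ℓ]))})) : x ∈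
                closure (⋃ n : ℕ, {a : Matrix (Fin 2) (Fin 2) ℤ_[ℓ] | ∃ g ∈ G,
                      (g : Matrix (Fin 2) (Fin 2) ℤ_[ℓ]).map ((↑) : ℤ_[ℓ] → ℚ_[ℓ]) =
                        NormedSpace.exp ((ℓ : ℚ_[ℓ]) ^ (n + 3) • a.map ((↑) : ℤ_[ℓ] → ℚ_[ℓ]))}) := by
  induction m with
  | zero => simpa using hx
  | succ m ih =>
    refine ih (mem_latticeInfty_of_smul_mem ?_)
    rwa [smul_smul, ← pow_succ']

/-! ### From the Lie lattice back to the group: invariant lines -/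

/-- **An invariant line of the Lie lattice is an invariant line of `G ∩ Γ(ℓ³)`.**  Let `E ⊇ ℚ_ℓ`
be a field and `v ∈ E²`.  If every `a ∈ Λ₃(G)` maps `v` into `E v`, then so does every
`g ∈ G ∩ Γ(ℓ³)`: `g = exp A` with `A = ℓ³ a`, `a ∈ Λ₃(G)`, and the stabiliser of the line `E v`
in `M₂(ℚ_ℓ)` is a (closed, unital) subalgebra containing every partial sum of `exp A`.
This is the only place where the exponential series itself is used. [folklore] -/
theorem exists_mulVec_eq_smul_of_forall_mem_lattice {G : Subgroup (GL (Fin 2) ℤ_[ℓ])}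
    {E : Type*} [Field E] [Algebra ℚ_[ℓ] E] {v : Fin 2 → E}
    (h : ∀ a ∈ {a : Matrix (Fin 2) (Fin 2) ℤ_[ℓ] | ∃ g ∈ G,
          (g : Matrix (Fin 2) (Fin 2) ℤ_[ℓ]).map ((↑) : ℤ_[ℓ] → ℚ_[ℓ]) =
            NormedSpace.exp ((ℓ : ℚ_[ℓ]) ^ 3 • a.map ((↑) : ℤ_[ℓ] → ℚ_[ℓ]))}, ∃ c : E, ((a.map ((↑) : ℤ_[ℓ] → ℚ_[ℓ])).map (algebraMap ℚ_[ℓ] E)) *ᵥ v = c • v)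
    {g : GL (Fin 2) ℤ_[ℓ]} (hgG : g ∈ G) (hg3 : g ∈ GL2.congruenceSubgroup (p := ℓ) 3) :
    ∃ c : E, (((g : Matrix (Fin 2) (Fin 2) ℤ_[ℓ]).map ((↑) : ℤ_[ℓ] → ℚ_[ℓ])).map (algebraMap ℚ_[ℓ] E)) *ᵥ v = c • v := by
  obtain ⟨a, ha, hga⟩ := exists_mem_lattice_of_mem le_rfl hgG hg3
  -- the stabiliser of the line, as a `ℚ_ℓ`-subspace of `M₂(ℚ_ℓ)`
  let K : Submodule ℚ_[ℓ] (Matrix (Fin 2) (Fin 2) ℚ_[ℓ]) :=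
    { carrier := {X | ∃ c : E, (X.map (algebraMap ℚ_[ℓ] E)) *ᵥ v = c • v}
      add_mem' := by
        rintro X Y ⟨c, hc⟩ ⟨d, hd⟩
        refine ⟨c + d, ?_⟩
        rw [Matrix.map_add _ (map_add _), Matrix.add_mulVec, hc, hd, add_smul]
      zero_mem' := ⟨0, by rw [Matrix.map_zero _ (map_zero _), Matrix.zero_mulVec, zero_smul]⟩
      smul_mem' := by
        rintro r X ⟨c, hc⟩
        refine ⟨algebraMap ℚ_[ℓ] E r * c, ?_⟩
        rw [Matrix.map_smul' _ _ _ (map_mul _), Matrix.smul_mulVec, hc, smul_smul] }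
  have hKmem : ∀ {X : Matrix (Fin 2) (Fin 2) ℚ_[ℓ]}, X ∈ K ↔ ∃ c : E, (X.map (algebraMap ℚ_[ℓ] E)) *ᵥ v = c • v :=
    Iff.rfl
  have hK1 : (1 : Matrix (Fin 2) (Fin 2) ℚ_[ℓ]) ∈ K :=
    hKmem.2 ⟨1, by rw [Matrix.map_one _ (map_zero _) (map_one _), Matrix.one_mulVec, one_smul]⟩
  have hKmul : ∀ {X Y : Matrix (Fin 2) (Fin 2) ℚ_[ℓ]}, X ∈ K → Y ∈ K → X * Y ∈ K := by
    intro X Y hX hY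
    obtain ⟨c, hc⟩ := hKmem.1 hX
    obtain ⟨d, hd⟩ := hKmem.1 hY
    refine hKmem.2 ⟨d * c, ?_⟩
    rw [Matrix.map_mul, ← Matrix.mulVec_mulVec, hd, Matrix.mulVec_smul, hc, smul_smul]
  have hKpow : ∀ {X : Matrix (Fin 2) (Fin 2) ℚ_[ℓ]}, X ∈ K → ∀ n : ℕ, X ^ n ∈ K := by
    intro X hX n
    induction n with
    | zero => rw [pow_zero]; exact hK1
    | succ n ih => rw [pow_succ]; exact hKmul ih hX
  have hKclosed : IsClosed (K : Set (Matrix (Fin 2) (Fin 2) ℚ_[ℓ])) := K.closed_of_finiteDimensional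
  -- `A = ℓ³ ι(a) ∈ K`
  set A : Matrix (Fin 2) (Fin 2) ℚ_[ℓ] := (ℓ : ℚ_[ℓ]) ^ 3 • a.map ((↑) : ℤ_[ℓ] → ℚ_[ℓ]) with hA
  have hAK : A ∈ K := K.smul_mem _ (hKmem.2 (h a ha))
  -- hence `exp A ∈ K`
  have hsum := hasSum_exp_of_box le_rfl (box_smul_map_coe 3 a)
  rw [← hA] at hsum
  have hexp : exp A ∈ K := by
    refine hKclosed.mem_of_tendsto hsum (Eventually.of_forall fun S ↦ ?_)
    exact K.sum_mem fun n _ ↦ K.smul_mem _ (hKpow hAK n)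
  rw [hga]
  exact hKmem.1 hexp

/-! ### The `ℚ_ℓ`-span of the Lie lattice -/

/-- The `ℚ_ℓ`-span `L` of `ι(Λ∞(G))` is closed under the bracket. [folklore] -/
theorem bracket_mem_span_latticeInfty {G : Subgroup (GL (Fin 2) ℤ_[ℓ])} {X Y : Matrix (Fin 2) (Fin 2) ℚ_[ℓ]}
    (hX : X ∈ Submodule.span ℚ_[ℓ] ((fun a : Matrix (Fin 2) (Fin 2) ℤ_[ℓ] ↦ a.map ((↑) : ℤ_[ℓ] → ℚ_[ℓ])) ''
        closure (⋃ n : ℕ, {a : Matrix (Fin 2) (Fin 2) ℤ_[ℓ] | ∃ g ∈ G,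
              (g : Matrix (Fin 2) (Fin 2) ℤ_[ℓ]).map ((↑) : ℤ_[ℓ] → ℚ_[ℓ]) =
                NormedSpace.exp ((ℓ : ℚ_[ℓ]) ^ (n + 3) • a.map ((↑) : ℤ_[ℓ] → ℚ_[ℓ]))})))
    (hY : Y ∈ Submodule.span ℚ_[ℓ] ((fun a : Matrix (Fin 2) (Fin 2) ℤ_[ℓ] ↦ a.map ((↑) : ℤ_[ℓ] → ℚ_[ℓ])) ''
        closure (⋃ n : ℕ, {a : Matrix (Fin 2) (Fin 2) ℤ_[ℓ] | ∃ g ∈ G,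
              (g : Matrix (Fin 2) (Fin 2) ℤ_[ℓ]).map ((↑) : ℤ_[ℓ] → ℚ_[ℓ]) =
                NormedSpace.exp ((ℓ : ℚ_[ℓ]) ^ (n + 3) • a.map ((↑) : ℤ_[ℓ] → ℚ_[ℓ]))}))) :
    X * Y - Y * X ∈ Submodule.span ℚ_[ℓ] ((fun a : Matrix (Fin 2) (Fin 2) ℤ_[ℓ] ↦ a.map ((↑) : ℤ_[ℓ] → ℚ_[ℓ])) ''
        closure (⋃ n : ℕ, {a : Matrix (Fin 2) (Fin 2) ℤ_[ℓ] | ∃ g ∈ G,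
              (g : Matrix (Fin 2) (Fin 2) ℤ_[ℓ]).map ((↑) : ℤ_[ℓ] → ℚ_[ℓ]) =
                NormedSpace.exp ((ℓ : ℚ_[ℓ]) ^ (n + 3) • a.map ((↑) : ℤ_[ℓ] → ℚ_[ℓ]))})) := by
  induction hX, hY using Submodule.span_induction₂ with
  | mem_mem X Y hX hY =>
    obtain ⟨a, ha, rfl⟩ := hX
    obtain ⟨b, hb, rfl⟩ := hY
    refine Submodule.subset_span ⟨a * b - b * a, bracket_mem_latticeInfty ha hb, ?_⟩
    simp only [map_coe_sub, map_coe_mul]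
  | zero_left Y hY => simp
  | zero_right X hX => simp
  | add_left X X' Y hX hX' hY h1 h2 =>
    have : (X + X') * Y - Y * (X + X') = (X * Y - Y * X) + (X' * Y - Y * X') := by noncomm_ring
    rw [this]; exact Submodule.add_mem _ h1 h2
  | add_right X Y Y' hX hY hY' h1 h2 =>
    have : X * (Y + Y') - (Y + Y') * X = (X * Y - Y * X) + (X * Y' - Y' * X) := by noncomm_ring
    rw [this]; exact Submodule.add_mem _ h1 h2
  | smul_left r X Y hX hY h1 =>
    have : (r • X) * Y - Y * (r • X) = r • (X * Y - Y * X) := by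
      rw [smul_mul_assoc, mul_smul_comm, smul_sub]
    rw [this]; exact Submodule.smul_mem _ _ h1
  | smul_right r X Y hX hY h1 =>
    have : X * (r • Y) - (r • Y) * X = r • (X * Y - Y * X) := by
      rw [smul_mul_assoc, mul_smul_comm, smul_sub]
    rw [this]; exact Submodule.smul_mem _ _ h1

/-- Every `ℓ`-adic number becomes integral after multiplication by a power of `ℓ`. [folklore] -/
theorem exists_norm_pow_mul_le_one (c : ℚ_[ℓ]) : ∃ k : ℕ, ‖(ℓ : ℚ_[ℓ]) ^ k * c‖ ≤ 1 := by
  have hp : ℓ.Prime := Fact.out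
  have hℓ : (0 : ℝ) < ℓ := by exact_mod_cast hp.pos
  obtain ⟨k, hk⟩ := pow_unbounded_of_one_lt ‖c‖ (by exact_mod_cast hp.one_lt : (1 : ℝ) < ℓ)
  refine ⟨k, ?_⟩
  rw [norm_mul, norm_pow, Padic.norm_p, inv_pow]
  have h0 : (0 : ℝ) < (ℓ : ℝ) ^ k := by positivity
  rw [inv_mul_le_iff₀ h0, mul_one]
  exact hk.le

/-- **The span sees no new integral points**: an integral matrix in the `ℚ_ℓ`-span of `ι(Λ∞(G))`
lies in `Λ∞(G)` (denominators are powers of `ℓ`, and `Λ∞(G)` is a saturated `ℤ_ℓ`-module).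
[folklore] -/
theorem mem_latticeInfty_of_map_mem_span {G : Subgroup (GL (Fin 2) ℤ_[ℓ])} {x : Matrix (Fin 2) (Fin 2) ℤ_[ℓ]}
    (hx : x.map ((↑) : ℤ_[ℓ] → ℚ_[ℓ]) ∈ Submodule.span ℚ_[ℓ] ((fun a : Matrix (Fin 2) (Fin 2) ℤ_[ℓ] ↦ a.map ((↑) : ℤ_[ℓ] → ℚ_[ℓ])) ''
        closure (⋃ n : ℕ, {a : Matrix (Fin 2) (Fin 2) ℤ_[ℓ] | ∃ g ∈ G,
              (g : Matrix (Fin 2) (Fin 2) ℤ_[ℓ]).map ((↑) : ℤ_[ℓ] → ℚ_[ℓ]) =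
                NormedSpace.exp ((ℓ : ℚ_[ℓ]) ^ (n + 3) • a.map ((↑) : ℤ_[ℓ] → ℚ_[ℓ]))}))) :
    x ∈ closure (⋃ n : ℕ, {a : Matrix (Fin 2) (Fin 2) ℤ_[ℓ] | ∃ g ∈ G,
          (g : Matrix (Fin 2) (Fin 2) ℤ_[ℓ]).map ((↑) : ℤ_[ℓ] → ℚ_[ℓ]) =
            NormedSpace.exp ((ℓ : ℚ_[ℓ]) ^ (n + 3) • a.map ((↑) : ℤ_[ℓ] → ℚ_[ℓ]))}) := by
  -- every element of the span is `ℓ^{-m} ι(y)` with `y ∈ Λ∞(G)`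
  have key : ∀ X ∈ Submodule.span ℚ_[ℓ] ((fun a : Matrix (Fin 2) (Fin 2) ℤ_[ℓ] ↦ a.map ((↑) : ℤ_[ℓ] → ℚ_[ℓ])) ''
      closure (⋃ n : ℕ, {a : Matrix (Fin 2) (Fin 2) ℤ_[ℓ] | ∃ g ∈ G,
            (g : Matrix (Fin 2) (Fin 2) ℤ_[ℓ]).map ((↑) : ℤ_[ℓ] → ℚ_[ℓ]) =
              NormedSpace.exp ((ℓ : ℚ_[ℓ]) ^ (n + 3) • a.map ((↑) : ℤ_[ℓ] → ℚ_[ℓ]))})),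
      ∃ m : ℕ, ∃ y ∈ closure (⋃ n : ℕ, {a : Matrix (Fin 2) (Fin 2) ℤ_[ℓ] | ∃ g ∈ G,
            (g : Matrix (Fin 2) (Fin 2) ℤ_[ℓ]).map ((↑) : ℤ_[ℓ] → ℚ_[ℓ]) =
              NormedSpace.exp ((ℓ : ℚ_[ℓ]) ^ (n + 3) • a.map ((↑) : ℤ_[ℓ] → ℚ_[ℓ]))}), (ℓ : ℚ_[ℓ]) ^ m • X = y.map ((↑) : ℤ_[ℓ] → ℚ_[ℓ]) := by
    intro X hX
    induction hX using Submodule.span_induction with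
    | mem X hX =>
      obtain ⟨a, ha, rfl⟩ := hX
      exact ⟨0, a, ha, by rw [pow_zero, one_smul]⟩
    | zero => exact ⟨0, 0, zero_mem_latticeInfty G, by rw [smul_zero, Matrix.map_zero _ PadicInt.coe_zero]⟩
    | add X Y hX hY h1 h2 =>
      obtain ⟨m, y, hy, hmy⟩ := h1
      obtain ⟨n, z, hz, hnz⟩ := h2
      refine ⟨m + n, (ℓ : ℤ_[ℓ]) ^ n • y + (ℓ : ℤ_[ℓ]) ^ m • z,
        add_mem_latticeInfty (smul_mem_latticeInfty hy _) (smul_mem_latticeInfty hz _), ?_⟩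
      have e1 : (ℓ : ℚ_[ℓ]) ^ (m + n) • X = (ℓ : ℚ_[ℓ]) ^ n • y.map ((↑) : ℤ_[ℓ] → ℚ_[ℓ]) := by
        rw [← hmy, smul_smul, ← pow_add, add_comm]
      have e2 : (ℓ : ℚ_[ℓ]) ^ (m + n) • Y = (ℓ : ℚ_[ℓ]) ^ m • z.map ((↑) : ℤ_[ℓ] → ℚ_[ℓ]) := by
        rw [← hnz, smul_smul, ← pow_add]
      rw [smul_add, e1, e2, map_coe_add, map_coe_smul, map_coe_smul, PadicInt.coe_pow, PadicInt.coe_pow,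
        PadicInt.coe_natCast]
    | smul r X hX h1 =>
      obtain ⟨m, y, hy, hmy⟩ := h1
      obtain ⟨k, hk⟩ := exists_norm_pow_mul_le_one r
      set d : ℤ_[ℓ] := ⟨(ℓ : ℚ_[ℓ]) ^ k * r, hk⟩ with hd
      refine ⟨k + m, d • y, smul_mem_latticeInfty hy _, ?_⟩
      have e1 : (ℓ : ℚ_[ℓ]) ^ (k + m) • r • X = ((ℓ : ℚ_[ℓ]) ^ k * r) • ((ℓ : ℚ_[ℓ]) ^ m • X) := by
        rw [smul_smul, smul_smul, pow_add]; ring_nf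
      rw [e1, hmy, map_coe_smul]
  obtain ⟨m, y, hy, hmy⟩ := key _ hx
  have hxy : (ℓ : ℤ_[ℓ]) ^ m • x = y := by
    refine Matrix.map_injective Subtype.val_injective ?_
    show ((ℓ : ℤ_[ℓ]) ^ m • x).map ((↑) : ℤ_[ℓ] → ℚ_[ℓ]) = y.map ((↑) : ℤ_[ℓ] → ℚ_[ℓ])
    rw [← hmy, map_coe_smul, PadicInt.coe_pow, PadicInt.coe_natCast]
  exact mem_latticeInfty_of_pow_smul_mem (m := m) (hxy ▸ hy)

end OpenImage

end Literature.NumberTheory.EllipticCurves.ModularForms
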